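import Mathlib
import HarnessLib
import Summits.NavierStokesRegularity.NavierStokesRegularity.Theorems.PoloidalWindowDoorPoloidalWindowRigidityThreadNoXPoint

/-!
# Route `PoloidalWindowDoor`, crux `PoloidalWindowRigidity` (K2, stmt-NavierStokesRegularity-19708) — LOCAL FUNCTIONAL
# DEPENDENCE of two planar functions with vanishing Poisson bracket (towards the null-present half of stub HP1
# `stub_islandOrNull`, line `hot_loops` v2, ns-idea-8 g6)

Cell ns-regularity-ideate, seat ns-poloidal-K2-p2 g11 (stub-worker on K2; `--supports` the crux item).

For `C¹` functions `f, G : ℝ × ℝ → ℝ` with `{f, G} = ∂₁f·∂₂G − ∂₂f·∂₁G ≡ 0`, near every point `q₀` with `∂₂f(q₀) ≠ 0`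
there is a function `κ : ℝ → ℝ` with **`dG = κ(f)·df`** on a neighbourhood (`G = φ ∘ f` locally, `κ = φ'`): the implicit
function `b = h(a, r)` of `f(a, b) = r` (Mathlib `ContDiffAt.implicitFunction`) straightens `f`, and `a ↦ G(a, h(a,r))`
has zero derivative by the bracket (`…ThreadNoXPoint.bracket_transfer`).  Consequence used downstream: in such a
neighbourhood the zeros of `dG` are exactly the points whose LEVEL `f` lies in the zero set of `κ` — zeros of the
Hamiltonian field `J∇G` propagate along whole level arcs of `f`.

* `exists_levelFactor` — the statement above (`∃ κ, ∃ V ∈ 𝓝 q₀, ∀ q ∈ V, fderiv G q = κ (f q) • fderiv f q ∧ ∂₂f q ≠ 0`).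

WHAT THIS IS NOT: not a claim about Navier–Stokes — elementary calculus (implicit function theorem) for one stub of an
ideator line of a door route (bears_on LADDER-NS N0, rung N0-LocalTubeDoorPoloidal).
-/

noncomputable section

-- the summit and its single sub-problem share the name (CONVENTIONS §1), as in every Theorems file
set_option linter.dupNamespace false

namespace Summit.NavierStokesRegularity.NavierStokesRegularity.Theorems.PoloidalWindowDoorPoloidalWindowRigidityLevelDependence

open Set Function Filter Topology Metric
open Summit.NavierStokesRegularity.NavierStokesRegularity.Theorems.PoloidalWindowDoorPoloidalWindowRigidityThreadNoXPoint

/-- **Local functional dependence from a vanishing bracket.**  `f, G ∈ C¹(ℝ²)` with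
`∂₁f·∂₂G − ∂₂f·∂₁G ≡ 0` and `∂₂f(q₀) ≠ 0`: there are `κ : ℝ → ℝ` and a neighbourhood `V` of `q₀` with
`dG(q) = κ(f(q))·df(q)` and `∂₂f(q) ≠ 0` for `q ∈ V`. -/
theorem exists_levelFactor {f G : ℝ × ℝ → ℝ} (hf : ContDiff ℝ 1 f) (hG : ContDiff ℝ 1 G)
    (hbr : ∀ q : ℝ × ℝ, fderiv ℝ f q (1, 0) * fderiv ℝ G q (0, 1) - fderiv ℝ f q (0, 1) * fderiv ℝ G q (1, 0) = 0)
    {q₀ : ℝ × ℝ} (hreg : fderiv ℝ f q₀ (0, 1) ≠ 0) :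
    ∃ κ : ℝ → ℝ, ∃ V ∈ 𝓝 q₀, ∀ q ∈ V, fderiv ℝ G q = κ (f q) • fderiv ℝ f q ∧ fderiv ℝ f q (0, 1) ≠ 0 := by
  have hfd : Differentiable ℝ f := hf.differentiable one_ne_zero
  have hGd : Differentiable ℝ G := hG.differentiable one_ne_zero
  have hfc : Continuous f := hf.continuous
  set a₀ : ℝ := q₀.1 with ha₀
  set b₀ : ℝ := q₀.2 with hb₀
  set c : ℝ := f q₀ with hc
  have hq₀ : q₀ = (a₀, b₀) := Prod.ext rfl rfl
  -- the implicit equation `F ((a, r), b) = f (a, b) - r = 0`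
  set F : (ℝ × ℝ) × ℝ → ℝ := fun x => f (x.1.1, x.2) - x.1.2 with hF
  set u : (ℝ × ℝ) × ℝ := ((a₀, c), b₀) with hu
  have hFc : ContDiff ℝ 1 F := by
    have h1 : ContDiff ℝ 1 fun x : (ℝ × ℝ) × ℝ => (x.1.1, x.2) := by fun_prop
    have h2 : ContDiff ℝ 1 fun x : (ℝ × ℝ) × ℝ => x.1.2 := by fun_prop
    exact (hf.comp h1).sub h2
  have hFc' : ContDiffAt ℝ 1 F u := hFc.contDiffAt
  have hFu : F u = 0 := by simp [hF, hu, hc, hq₀]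
  -- the partial derivative in `b` is `∂₂f(q₀) ≠ 0`
  have hFd : ∀ b' : ℝ, fderiv ℝ F u (ContinuousLinearMap.inr ℝ (ℝ × ℝ) ℝ b') = fderiv ℝ f q₀ (0, 1) * b' := by
    intro b'
    have h1 : HasFDerivAt (fun x : (ℝ × ℝ) × ℝ => (x.1.1, x.2))
        ((ContinuousLinearMap.fst ℝ ℝ ℝ).comp (ContinuousLinearMap.fst ℝ (ℝ × ℝ) ℝ) |>.prod
          (ContinuousLinearMap.snd ℝ (ℝ × ℝ) ℝ)) u :=
      ((ContinuousLinearMap.fst ℝ ℝ ℝ).comp (ContinuousLinearMap.fst ℝ (ℝ × ℝ) ℝ) |>.prod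
        (ContinuousLinearMap.snd ℝ (ℝ × ℝ) ℝ)).hasFDerivAt
    have h2 : HasFDerivAt (fun x : (ℝ × ℝ) × ℝ => x.1.2)
        ((ContinuousLinearMap.snd ℝ ℝ ℝ).comp (ContinuousLinearMap.fst ℝ (ℝ × ℝ) ℝ)) u :=
      ((ContinuousLinearMap.snd ℝ ℝ ℝ).comp (ContinuousLinearMap.fst ℝ (ℝ × ℝ) ℝ)).hasFDerivAt
    have h3 : HasFDerivAt F ((fderiv ℝ f (u.1.1, u.2)).comp
        ((ContinuousLinearMap.fst ℝ ℝ ℝ).comp (ContinuousLinearMap.fst ℝ (ℝ × ℝ) ℝ) |>.prod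
          (ContinuousLinearMap.snd ℝ (ℝ × ℝ) ℝ)) -
        (ContinuousLinearMap.snd ℝ ℝ ℝ).comp (ContinuousLinearMap.fst ℝ (ℝ × ℝ) ℝ)) u :=
      ((hfd _).hasFDerivAt.comp u h1).sub h2
    rw [h3.fderiv]
    have hu1 : (u.1.1, u.2) = q₀ := by rw [hu, hq₀]
    simp [hu1]
    rw [show ((0 : ℝ), b') = b' • ((0 : ℝ), (1 : ℝ)) by simp, map_smul, smul_eq_mul, mul_comm]
  have hFd' : ∀ b' : ℝ, fderiv ℝ F u ((0 : ℝ × ℝ), b') = fderiv ℝ f q₀ (0, 1) * b' := fun b' => by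
    simpa using hFd b'
  have hinv : (fderiv ℝ F u ∘L ContinuousLinearMap.inr ℝ (ℝ × ℝ) ℝ).IsInvertible := by
    have hkey : fderiv ℝ F u ∘L ContinuousLinearMap.inr ℝ (ℝ × ℝ) ℝ =
        fderiv ℝ f q₀ (0, 1) • (1 : ℝ →L[ℝ] ℝ) := by
      ext
      simp [hFd']
    rw [hkey]
    refine ⟨ContinuousLinearEquiv.unitsEquivAut ℝ (Units.mk0 _ hreg), ?_⟩
    ext
    simp [mul_comm]
  -- the implicit function `h (a, r)`
  set h : ℝ × ℝ → ℝ := hFc'.implicitFunction one_ne_zero hinv with hh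
  have hh0 : h (a₀, c) = b₀ := hFc'.implicitFunction_apply_self one_ne_zero hinv
  have hhF : ∀ᶠ x in 𝓝 (a₀, c), F (x, h x) = F u := hFc'.eventually_apply_implicitFunction one_ne_zero hinv
  have hhiff : ∀ᶠ xy in 𝓝 u, F xy = F u ↔ h xy.1 = xy.2 :=
    hFc'.eventually_apply_eq_iff_implicitFunction one_ne_zero hinv
  have hhc1 : ContDiffAt ℝ 1 h (a₀, c) := hFc'.contDiffAt_implicitFunction one_ne_zero hinv
  have hhd : ∀ᶠ x in 𝓝 (a₀, c), DifferentiableAt ℝ h x := by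
    filter_upwards [hhc1.eventually (by simp)] with x hx
    exact hx.differentiableAt one_ne_zero
  -- continuity of the partial `∂₂f`
  have hf2c : Continuous fun q : ℝ × ℝ => fderiv ℝ f q (0, 1) :=
    (hf.continuous_fderiv one_ne_zero).clm_apply continuous_const
  -- (1) a product neighbourhood of `(a₀, c)` on which the implicit function behaves
  have hev1 : ∀ᶠ x in 𝓝 (a₀, c), f (x.1, h x) = x.2 ∧ DifferentiableAt ℝ h x ∧ fderiv ℝ f (x.1, h x) (0, 1) ≠ 0 := by
    have hA : ∀ᶠ x in 𝓝 (a₀, c), f (x.1, h x) = x.2 := by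
      filter_upwards [hhF] with x hx
      have : F (x, h x) = 0 := by rw [hx, hFu]
      simpa [hF, sub_eq_zero] using this
    have hcont : ContinuousAt (fun x : ℝ × ℝ => fderiv ℝ f (x.1, h x) (0, 1)) (a₀, c) := by
      have h1 : ContinuousAt (fun x : ℝ × ℝ => (x.1, h x)) (a₀, c) :=
        continuousAt_fst.prodMk hhc1.continuousAt
      exact hf2c.continuousAt.comp h1
    have hC : ∀ᶠ x in 𝓝 (a₀, c), fderiv ℝ f (x.1, h x) (0, 1) ≠ 0 := by
      refine hcont.eventually_ne ?_
      show fderiv ℝ f ((a₀, c).1, h (a₀, c)) (0, 1) ≠ 0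
      rw [hh0, ← hq₀]; exact hreg
    exact hA.and (hhd.and hC)
  obtain ⟨ε, hε, hball⟩ := Metric.eventually_nhds_iff.1 hev1
  have hbox : ∀ a r : ℝ, |a - a₀| < ε → |r - c| < ε →
      f (a, h (a, r)) = r ∧ DifferentiableAt ℝ h (a, r) ∧ fderiv ℝ f (a, h (a, r)) (0, 1) ≠ 0 := by
    intro a r ha hr
    have hd : dist (a, r) (a₀, c) < ε := by
      rw [Prod.dist_eq]; exact max_lt (by rwa [Real.dist_eq]) (by rwa [Real.dist_eq])
    exact hball hd
  -- (2) the candidate `φ` and its derivative `κ`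
  set φ : ℝ → ℝ := fun r => G (a₀, h (a₀, r)) with hφ
  have hφd : ∀ r : ℝ, |r - c| < ε → DifferentiableAt ℝ φ r := by
    intro r hr
    have hhr : DifferentiableAt ℝ h (a₀, r) := (hbox a₀ r (by simp [hε]) hr).2.1
    have h1 : DifferentiableAt ℝ (fun r : ℝ => h (a₀, r)) r :=
      hhr.comp r (differentiableAt_const _ |>.prodMk differentiableAt_id)
    exact (hGd _).comp r ((differentiableAt_const _).prodMk h1)
  -- (3) `G (a, h (a, r)) = φ r` on the box: zero `a`-derivative by the bracket
  have hconst : ∀ a r : ℝ, |a - a₀| < ε → |r - c| < ε → G (a, h (a, r)) = φ r := by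
    intro a r ha hr
    -- derivative of `a ↦ G (a, h (a, r))` vanishes on the interval `|a - a₀| < ε`
    have hder : ∀ a' : ℝ, |a' - a₀| < ε → HasDerivAt (fun a => G (a, h (a, r))) 0 a' := by
      intro a' ha'
      obtain ⟨-, hdiff, hne⟩ := hbox a' r ha' hr
      set D : ℝ := fderiv ℝ h (a', r) (1, 0) with hD
      have hpath : HasDerivAt (fun a : ℝ => (a, h (a, r))) ((1 : ℝ), D) a' := by
        have h1 : HasDerivAt (fun a : ℝ => h (a, r)) D a' := by
          have hc : HasDerivAt (fun a : ℝ => ((a, r) : ℝ × ℝ)) ((1 : ℝ), (0 : ℝ)) a' :=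
            (hasDerivAt_id a').prodMk (hasDerivAt_const a' r)
          exact hdiff.hasFDerivAt.comp_hasDerivAt a' hc
        exact (hasDerivAt_id a').prodMk h1
      have hn : HasDerivAt (fun a => f (a, h (a, r))) (fderiv ℝ f (a', h (a', r)) ((1 : ℝ), D)) a' :=
        (hfd _).hasFDerivAt.comp_hasDerivAt a' hpath
      have hm : HasDerivAt (fun a => G (a, h (a, r))) (fderiv ℝ G (a', h (a', r)) ((1 : ℝ), D)) a' :=
        (hGd _).hasFDerivAt.comp_hasDerivAt a' hpath
      -- `a ↦ f (a, h (a, r))` is the constant `r` near `a'`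
      have hn0 : HasDerivAt (fun a => f (a, h (a, r))) 0 a' := by
        have hopen : IsOpen {a : ℝ | |a - a₀| < ε} := isOpen_lt (continuous_id.sub continuous_const).abs continuous_const
        have hloc : (fun a => f (a, h (a, r))) =ᶠ[𝓝 a'] fun _ => r := by
          filter_upwards [hopen.mem_nhds ha'] with a ha
          exact (hbox a r ha hr).1
        exact (hasDerivAt_const a' r).congr_of_eventuallyEq hloc
      have hzero : fderiv ℝ f (a', h (a', r)) ((1 : ℝ), D) = 0 := hn.unique hn0
      have hsplit : (((1 : ℝ), D) : ℝ × ℝ) = ((1 : ℝ), (0 : ℝ)) + D • ((0 : ℝ), (1 : ℝ)) := by ext <;> simp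
      have hfz : fderiv ℝ f (a', h (a', r)) (1, 0) + D * fderiv ℝ f (a', h (a', r)) (0, 1) = 0 := by
        rw [hsplit, map_add, map_smul, smul_eq_mul] at hzero; exact hzero
      have hGz := bracket_transfer (hbr (a', h (a', r))) hne hfz
      have hGz' : fderiv ℝ G (a', h (a', r)) ((1 : ℝ), D) = 0 := by
        rw [hsplit, map_add, map_smul, smul_eq_mul]; exact hGz
      rw [hGz'] at hm
      exact hm
    have hI : ∀ a' ∈ Ioo (a₀ - ε) (a₀ + ε), |a' - a₀| < ε := fun a' ha' => by
      rw [abs_lt]; constructor <;> linarith [ha'.1, ha'.2]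
    have heq := isOpen_Ioo.is_const_of_deriv_eq_zero (𝕜 := ℝ) (f := fun a => G (a, h (a, r)))
      isPreconnected_Ioo (fun a' ha' => (hder a' (hI a' ha')).differentiableAt.differentiableWithinAt)
      (fun a' ha' => (hder a' (hI a' ha')).deriv)
      (show a ∈ Ioo (a₀ - ε) (a₀ + ε) by rw [abs_lt] at ha; constructor <;> linarith [ha.1, ha.2])
      (show a₀ ∈ Ioo (a₀ - ε) (a₀ + ε) by constructor <;> linarith)
    rw [heq]
  -- (4) near `q₀`: `h (a, f (a, b)) = b`, the box conditions, and `∂₂f ≠ 0`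
  have hev2 : ∀ᶠ q in 𝓝 q₀, h (q.1, f q) = q.2 ∧ |q.1 - a₀| < ε ∧ |f q - c| < ε ∧ fderiv ℝ f q (0, 1) ≠ 0 := by
    have hT : ContinuousAt (fun q : ℝ × ℝ => (((q.1, f q) : ℝ × ℝ), q.2)) q₀ :=
      (continuousAt_fst.prodMk hfc.continuousAt).prodMk continuousAt_snd
    have hTu : (fun q : ℝ × ℝ => (((q.1, f q) : ℝ × ℝ), q.2)) q₀ = u := by rw [hu, hq₀]
    have hA : ∀ᶠ q in 𝓝 q₀, h (q.1, f q) = q.2 := by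
      have h1 := hT.eventually (by rw [hTu]; exact hhiff)
      filter_upwards [h1] with q hq
      have : F ((q.1, f q), q.2) = F u := by rw [hFu]; simp [hF]
      exact hq.1 this
    have hB : ∀ᶠ q in 𝓝 q₀, |q.1 - a₀| < ε := by
      have h1 : ContinuousAt (fun q : ℝ × ℝ => |q.1 - a₀|) q₀ := by fun_prop
      refine h1.eventually_lt continuousAt_const ?_
      simp [hq₀, hε]
    have hC : ∀ᶠ q in 𝓝 q₀, |f q - c| < ε := by
      have h1 : ContinuousAt (fun q : ℝ × ℝ => |f q - c|) q₀ := by fun_prop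
      refine h1.eventually_lt continuousAt_const ?_
      simp [hc, hε]
    have hD : ∀ᶠ q in 𝓝 q₀, fderiv ℝ f q (0, 1) ≠ 0 := hf2c.continuousAt.eventually_ne hreg
    exact hA.and (hB.and (hC.and hD))
  obtain ⟨V, hVmem, hVopen, hV⟩ : ∃ V ∈ 𝓝 q₀, IsOpen V ∧
      ∀ q ∈ V, h (q.1, f q) = q.2 ∧ |q.1 - a₀| < ε ∧ |f q - c| < ε ∧ fderiv ℝ f q (0, 1) ≠ 0 := by
    obtain ⟨V, hVsub, hVopen, hq₀V⟩ := _root_.mem_nhds_iff.1 hev2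
    exact ⟨V, hVopen.mem_nhds hq₀V, hVopen, fun q hq => hVsub hq⟩
  -- (5) on `V`, `G = φ ∘ f`, hence `dG = φ'(f) df`
  have hGφ : ∀ q ∈ V, G q = φ (f q) := by
    intro q hq
    obtain ⟨hhq, ha, hr, -⟩ := hV q hq
    have := hconst q.1 (f q) ha hr
    rw [hhq] at this
    exact this
  refine ⟨deriv φ, V, hVmem, fun q hq => ⟨?_, (hV q hq).2.2.2⟩⟩
  have hloc : G =ᶠ[𝓝 q] (φ ∘ f) := by
    filter_upwards [hVopen.mem_nhds hq] with q' hq'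
    exact hGφ q' hq'
  rw [hloc.fderiv_eq]
  exact ((hφd (f q) (hV q hq).2.2.1).hasDerivAt.comp_hasFDerivAt q (hfd q).hasFDerivAt).fderiv

end Summit.NavierStokesRegularity.NavierStokesRegularity.Theorems.PoloidalWindowDoorPoloidalWindowRigidityLevelDependence

end
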